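import Summits.RiemannHypothesis.RiemannHypothesis.Theses.SignCone
import Summits.RiemannHypothesis.RiemannHypothesis.Theorems.SignConeOscillatory.Negative.OriginDominatingCells
import Summits.RiemannHypothesis.RiemannHypothesis.Theorems.OscSingleWindow.Negative.WithoutPDOriginDominatingNumerics
import Summits.RiemannHypothesis.RiemannHypothesis.Theorems.OscSingleWindow.Negative.WithoutPDOriginDominatingWitness
import Literature.NumberTheory.LFunctions.WeilExplicitArchTermProofs
import Literature.NumberTheory.LFunctions.WeilMellinBounds
import Mathlib.Analysis.SpecialFunctions.ImproperIntegrals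
import Mathlib.MeasureTheory.Integral.ExpDecay

/-!
# `OscSingleWindow` (crux stmt-RiemannHypothesis-18012) — negative lemma: origin domination does not
# substitute for positive-definiteness, even inside the single high window
(route `SignCone`; crux-disprover record of seat `refuter-cdisprove-stmt-RiemannHypothesis-18012-0`, cycle 1;
`--supports` — it closes nothing)

The crux `Summit.RiemannHypothesis.RiemannHypothesis.Theses.SignCone.OscSingleWindow` is the unit-slack sign-cone
inequality `-Re F(0) ≤ Re W_ar(F)` for node-nonnegative AUTOCORRELATION SUMS `F = Σᵢ gᵢ ⋆ g̃ᵢ` whose far-field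
negativity is confined to ONE window `T ≤ |t| ≤ T + log 2`, `T ≥ 3`.  The parent crux's lemma
`SignConeOscillatory.Negative.signConeOscillatory_false_without_PD_originDominating` (dips at heights `0.5 … 2.14`)
is NOT a single-window witness.  Here the same mutation is refuted INSIDE the single-window class, where every
far-field dip must sit at height `≥ 3` strictly between consecutive nodes `log n < t < log (n+1)` (gaps `≍ 1/n`):

* `oscSingleWindow_false_without_PD_originDominating` — replace "`F = Σᵢ gᵢ ⋆ g̃ᵢ`, `supp gᵢ ⊆ [-a, a]`" by
  "`F` smooth, compactly supported in `[-2a, 2a]`, hermitian AND origin-dominating (`‖F u‖ ≤ Re F(0)`)", keeping the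
  node hypothesis, the single-window hypothesis (`T ≥ 3`), the oscillation hypothesis and the conclusion VERBATIM:
  FALSE.

Witness (`a = 1.67`, window `T = 3`): the real even plateau comb
`F = β₀ - Σ_{i<5} (βᵢ(· - cᵢ) + βᵢ(· + cᵢ))` (`SignConeOscillatory.Negative.OriginDominatingComb`): central plateau
`β₀` (`rIn = 0.28`, `rOut = 0.32`), one NEAR-FIELD negative plateau centred at `0.5` (support `(0.32, 0.68)`, below
`log 2`, where the class imposes no sign), and four negative unit plateaus in the window, centred at
`3.0217, 3.19845, 3.2381, 3.3137` with supports `(3.0003, 3.0431) ⊂ (3, log 21)`, `(3.1784, 3.2185) ⊂ (log 24, log 25)`,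
`(3.2192, 3.2570) ⊂ (log 25, log 26)`, `(3.2962, 3.3312) ⊂ (log 27, log 28)` (node gaps certified from Mathlib's
`log 2, log 3, log 5` decimals and `log (m+1) ≥ log m + 1/(m+1)`).  Then `F(0) = 1 ≥ |F|`, `F(log n) = 0` for all
`n ≥ 2`, `F = 0` on `log 2 ≤ |t| ≤ 3.0003` and on `|t| ≥ 3.3312` (so the far-field negativity lies in `[3, 3 + log 2]`),
`F(3.0217) = -1`; and with Bombieri's form of the archimedean term (`weilArchTermBombieri_eq_weilArchTerm_holds`)
`Re W_ar(F) + 1 = 1 - (log 4π + γ) + ∫₀^∞ D`, `D(t) = 2F(t)(e^{-t/2} + e^{t/2}) - (e^{t/2}F(t) - 1)/sinh t`; the 25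
cell bounds of `WithoutPDOriginDominatingNumerics.lean` (the six near-field cells are the parent's `ncell0 … ncell5`) plus the tail `t ≥ 3.3312` give
`∫₀^∞ D ≤ 1.6569 + 0.07161 `, whence `Re W_ar(F) + Re F(0) ≤ -0.256 < 0`.

Reading for provers: each between-node dip of depth `F(0)` in the gap above `n` GAINS `≈ 2·(1/n)·2cosh(log n /2)
≈ 2/√n` units of `F(0)` in Bombieri's position-space form with NO width penalty, so four gaps at height `3` already
overturn the unit slack plus the whole near-field budget; summed over one octave the free gain is `≍ √(e^T)`.  This is
the quantity the crux's mechanism must charge to positive-definiteness (`F̂ ≥ 0`) — the "completion cost" — and it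
must do so at EVERY height `T ≥ 3`; origin domination, hermitian symmetry, node signs and the window geometry
together carry none of it.
-/

noncomputable section

-- `Summit.RiemannHypothesis.RiemannHypothesis.…` repeats a namespace component by design (D-0017 layout).
set_option linter.dupNamespace false

open scoped BigOperators ComplexConjugate Topology
open Complex MeasureTheory Set Filter intervalIntegral

namespace Summit.RiemannHypothesis.RiemannHypothesis.Theorems.OscSingleWindow.Negative

open Literature.NumberTheory.LFunctions
open Summit.RiemannHypothesis.RiemannHypothesis.Theorems.SignConeOscillatory.Negative

/-! ## The partition `x`, the bounds `M`, and the dispatch -/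

/-- The partition: `x 0 = 0`, `x 25 = 3.3312`, monotone, nonnegative. -/
theorem sw_grid_facts {x : ℕ → ℝ} (hx : x = fun i => ([(0 : ℝ), 0.28, 0.32, 0.36, 0.5, 0.64, 0.68, 0.74, 0.82, 0.92, 1.04, 1.18, 1.35, 1.55, 1.8, 2.12, 2.52, 3.0033, 3.0401, 3.1814, 3.2155, 3.2222, 3.254, 3.2992, 3.3282, 3.3312] : List ℝ).getD i 3.3312) :
    x 0 = 0 ∧ x 25 = 3.3312 ∧ (∀ i < 25, x i ≤ x (i + 1)) ∧ (∀ i < 25, 0 ≤ x i) := by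
  refine ⟨by simp only [hx, List.getD_cons_zero], by simp only [hx, List.getD_cons_succ, List.getD_cons_zero],
    fun i hi => ?_, fun i hi => ?_⟩
  · interval_cases i <;> simp only [hx, List.getD_cons_succ, List.getD_cons_zero] <;> norm_num
  · interval_cases i <;> simp only [hx, List.getD_cons_succ, List.getD_cons_zero] <;> norm_num

/-- The Riemann sum of the cell bounds: `Σᵢ Mᵢ (xᵢ₊₁ - xᵢ) ≤ 1.6569`. -/
theorem sw_cells_sum {x M : ℕ → ℝ} (hx : x = fun i => ([(0 : ℝ), 0.28, 0.32, 0.36, 0.5, 0.64, 0.68, 0.74, 0.82, 0.92, 1.04, 1.18, 1.35, 1.55, 1.8, 2.12, 2.52, 3.0033, 3.0401, 3.1814, 3.2155, 3.2222, 3.254, 3.2992, 3.3282, 3.3312] : List ℝ).getD i 3.3312)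
    (hM : M = fun i => ([(4.03928 : ℝ), 3.97114, 3.07231, 1.90855, 0.25749, 1.46073, 1.3631, 1.23548, 1.09287, 0.94754, 0.80785, 0.67865, 0.55585, 0.44454, 0.3399, 0.24359, 0.16198, -8.87757, 0.09589, -9.73045, 0.08042, -9.93612, 0.07737, -10.33533, 0.07182] : List ℝ).getD i 0) :
    ∑ i ∈ Finset.range 25, M i * (x (i + 1) - x i) ≤ 1.6569 := by
  simp only [Finset.sum_range_succ, Finset.sum_range_zero, hx, hM, List.getD_cons_succ, List.getD_cons_zero]
  norm_num

/-- **Dispatch of the 25 cells.**  If `D(t) = f(t)·B(e^{t/2}) + 2v²/(v⁴-1)` for `t > 0` and `f` takes the witness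
values (`f = 1` on `(0, 0.28)`, `0 ≤ f ≤ 1` on `(0.28, 0.32)`, `f ≤ 0` beyond `0.32`, `f = -1` on the five
plateaus), then `D ≤ Mᵢ` on the `i`-th cell. -/
theorem sw_cells_dispatch {f D : ℝ → ℝ} {x M : ℕ → ℝ} (hx : x = fun i => ([(0 : ℝ), 0.28, 0.32, 0.36, 0.5, 0.64, 0.68, 0.74, 0.82, 0.92, 1.04, 1.18, 1.35, 1.55, 1.8, 2.12, 2.52, 3.0033, 3.0401, 3.1814, 3.2155, 3.2222, 3.254, 3.2992, 3.3282, 3.3312] : List ℝ).getD i 3.3312)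
    (hM : M = fun i => ([(4.03928 : ℝ), 3.97114, 3.07231, 1.90855, 0.25749, 1.46073, 1.3631, 1.23548, 1.09287, 0.94754, 0.80785, 0.67865, 0.55585, 0.44454, 0.3399, 0.24359, 0.16198, -8.87757, 0.09589, -9.73045, 0.08042, -9.93612, 0.07737, -10.33533, 0.07182] : List ℝ).getD i 0)
    (hD : ∀ t, 0 < t → D t = f t * (2 * (Real.exp (t / 2) + (Real.exp (t / 2))⁻¹) - 2 * Real.exp (t / 2) ^ 3 / (Real.exp (t / 2) ^ 4 - 1)) +
        2 * Real.exp (t / 2) ^ 2 / (Real.exp (t / 2) ^ 4 - 1))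
    (W_pos1 : ∀ t ∈ Ioo (0 : ℝ) 0.28, f t = 1) (W_possh : ∀ t ∈ Ioo (0.28 : ℝ) 0.32, 0 ≤ f t ∧ f t ≤ 1)
    (W_nonpos : ∀ t, 0.32 ≤ t → f t ≤ 0)
    (W_plateau : ∀ t : ℝ, (t ∈ Icc (0.36 : ℝ) 0.64 → f t = -1) ∧
      (t ∈ Icc (3.0033 : ℝ) 3.0401 → f t = -1) ∧
      (t ∈ Icc (3.1814 : ℝ) 3.2155 → f t = -1) ∧
      (t ∈ Icc (3.2222 : ℝ) 3.254 → f t = -1) ∧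
      (t ∈ Icc (3.2992 : ℝ) 3.3282 → f t = -1)) :
    ∀ i < 25, ∀ t ∈ Ioo (x i) (x (i + 1)), D t ≤ M i := by
  intro i hi
  interval_cases i <;> intro t ht <;>
    simp only [hx, hM, List.getD_cons_succ, List.getD_cons_zero] at ht ⊢ <;>
    rw [hD t (by linarith [ht.1])]
  · exact ncell0 ht (W_pos1 t ht)
  · exact ncell1 ht (W_possh t ht).1 (W_possh t ht).2
  · exact ncell2 ht (W_nonpos t (by linarith [ht.1]))
  · exact ncell3 ht ((W_plateau t).1 ⟨by linarith [ht.1], by linarith [ht.2]⟩)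
  · exact ncell4 ht ((W_plateau t).1 ⟨by linarith [ht.1], by linarith [ht.2]⟩)
  · exact ncell5 ht (W_nonpos t (by linarith [ht.1]))
  · exact swcell6 ht (W_nonpos t (by linarith [ht.1]))
  · exact swcell7 ht (W_nonpos t (by linarith [ht.1]))
  · exact swcell8 ht (W_nonpos t (by linarith [ht.1]))
  · exact swcell9 ht (W_nonpos t (by linarith [ht.1]))
  · exact swcell10 ht (W_nonpos t (by linarith [ht.1]))
  · exact swcell11 ht (W_nonpos t (by linarith [ht.1]))
  · exact swcell12 ht (W_nonpos t (by linarith [ht.1]))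
  · exact swcell13 ht (W_nonpos t (by linarith [ht.1]))
  · exact swcell14 ht (W_nonpos t (by linarith [ht.1]))
  · exact swcell15 ht (W_nonpos t (by linarith [ht.1]))
  · exact swcell16 ht (W_nonpos t (by linarith [ht.1]))
  · exact swcell17 ht ((W_plateau t).2.1 ⟨by linarith [ht.1], by linarith [ht.2]⟩)
  · exact swcell18 ht (W_nonpos t (by linarith [ht.1]))
  · exact swcell19 ht ((W_plateau t).2.2.1 ⟨by linarith [ht.1], by linarith [ht.2]⟩)
  · exact swcell20 ht (W_nonpos t (by linarith [ht.1]))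
  · exact swcell21 ht ((W_plateau t).2.2.2.1 ⟨by linarith [ht.1], by linarith [ht.2]⟩)
  · exact swcell22 ht (W_nonpos t (by linarith [ht.1]))
  · exact swcell23 ht ((W_plateau t).2.2.2.2 ⟨by linarith [ht.1], by linarith [ht.2]⟩)
  · exact swcell24 ht (W_nonpos t (by linarith [ht.1]))

/-! ## The main theorem -/

/-- **Origin domination does not rescue positive-definiteness inside the single window.** The crux
`OscSingleWindow` with its cone structure replaced by "`F` smooth, compactly supported in `[-2a, 2a]`, hermitian and
origin-dominating (`‖F u‖ ≤ Re F(0)`)" — node hypothesis, single-window hypothesis (`T ≥ 3`), oscillation hypothesis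
and conclusion verbatim — is FALSE.  Witness: the plateau comb of the module docstring at `a = 1.67`, window
`T = 3`. -/
theorem oscSingleWindow_false_without_PD_originDominating : ¬ (∀ a : ℝ, 0 < a → ∀ F : ℝ → ℂ, (ContDiff ℝ ((⊤ : ℕ∞) : WithTop ℕ∞) F ∧ HasCompactSupport F) ∧ tsupport F ⊆ Set.Icc (-(2 * a)) (2 * a) → (∀ u : ℝ, F (-u) = (starRingEnd ℂ) (F u)) → (∀ u : ℝ, ‖F u‖ ≤ (F 0).re) → (∀ n : ℕ, 2 ≤ n → 0 ≤ (F (Real.log n)).re) → (∃ T : ℝ, 3 ≤ T ∧ ∀ t : ℝ, Real.log 2 ≤ |t| → (F t).re < 0 → T ≤ |t| ∧ |t| ≤ T + Real.log 2) → (∃ t : ℝ, Real.log 2 ≤ |t| ∧ (F t).re < 0) → let M : ℂ → ℂ := fun s => ∫ u : ℝ, F u * Complex.exp ((s - 1 / 2) * u); -(F 0).re ≤ (M 0 + M 1 + ((1 / (2 * Real.pi) : ℂ) * (∫ t : ℝ, M (1 / 2 + t * Complex.I) * ((Complex.digamma (1 / 4 + t / 2 * Complex.I)).re : ℂ)) -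 F 0 * (Real.log Real.pi : ℂ))).re) := by
  intro h
  /- ### the witness -/
  obtain ⟨b₀, hb₀⟩ : ∃ b₀ : ContDiffBump (0 : ℝ), b₀ = ⟨0.28, 0.32, by norm_num, by norm_num⟩ := ⟨_, rfl⟩
  obtain ⟨b, hb⟩ : ∃ b : Fin 5 → ContDiffBump (0 : ℝ), b =
      ![⟨0.14, 0.18, by norm_num, by norm_num⟩, ⟨0.0184, 0.0214, by norm_num, by norm_num⟩,
        ⟨0.01705, 0.02005, by norm_num, by norm_num⟩, ⟨0.0159, 0.0189, by norm_num, by norm_num⟩,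
        ⟨0.0145, 0.0175, by norm_num, by norm_num⟩] := ⟨_, rfl⟩
  obtain ⟨c, hc⟩ : ∃ c : Fin 5 → ℝ, c = ![0.5, 3.0217, 3.19845, 3.2381, 3.3137] := ⟨_, rfl⟩
  obtain ⟨f, hf⟩ : ∃ f : ℝ → ℝ, f = fun u => b₀ u - ∑ i, (b i (u - c i) + b i (u + c i)) := ⟨_, rfl⟩
  obtain ⟨F, hFdef⟩ : ∃ F : ℝ → ℂ, F = fun u => ((f u : ℝ) : ℂ) := ⟨_, rfl⟩
  have hb₀in : b₀.rIn = 0.28 := by rw [hb₀]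
  have hb₀out : b₀.rOut = 0.32 := by rw [hb₀]
  have hbin : ∀ i, (b i).rIn = (![0.14, 0.0184, 0.01705, 0.0159, 0.0145] : Fin 5 → ℝ) i := by
    intro i; rw [hb]; fin_cases i <;> rfl
  have hbout : ∀ i, (b i).rOut = (![0.18, 0.0214, 0.02005, 0.0189, 0.0175] : Fin 5 → ℝ) i := by
    intro i; rw [hb]; fin_cases i <;> rfl
  have W_far := sw_far hb₀out hbout hc
  have W_sep := sw_sep hbout hc
  have W_pos1 := sw_pos1 hb₀in hbout hc hf
  have W_possh := sw_possh hbout hc hf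
  have W_nonpos := sw_nonpos hb₀out hbout hc hf
  have W_plateau := sw_plateau hb₀out hbin hbout hc hf
  /- ### structural properties -/
  have hfs : ContDiff ℝ ((⊤ : ℕ∞) : WithTop ℕ∞) f := comb_contDiff hf
  have hfc : HasCompactSupport f := comb_hasCompactSupport hf
  have hFtest : IsWeilTest F := by
    rw [hFdef]; exact ⟨ofRealCLM.contDiff.comp hfs, hfc.comp_left Complex.ofReal_zero⟩
  have hFapp : ∀ u, F u = ((f u : ℝ) : ℂ) := fun u => by rw [hFdef]
  have hf0 : f 0 = 1 := sw_zero hb₀in hbout hc hf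
  have hF0 : F 0 = 1 := by rw [hFapp, hf0]; simp
  have hzeroR : ∀ u, 3.3312 ≤ |u| → f u = 0 := fun u hu => sw_zeroR hb₀out hbout hc hf hu
  have hzeroM : ∀ u, 0.68 ≤ u → u ≤ 3.0003 → f u = 0 := fun u hu1 hu2 => sw_zero_mid hb₀out hbout hc hf hu1 hu2
  have hsupp : tsupport F ⊆ Set.Icc (-(2 * (1.67 : ℝ))) (2 * (1.67)) := by
    refine closure_minimal (fun u hu => ?_) isClosed_Icc
    rw [Function.mem_support, hFapp] at hu
    have hu' : f u ≠ 0 := fun h0 => hu (by simp [h0])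
    by_contra habs
    refine hu' (hzeroR u ?_)
    rw [mem_Icc, not_and_or, not_le, not_le] at habs
    rcases habs with h' | h'
    · linarith [neg_le_abs u]
    · linarith [le_abs_self u]
  have hfeven : ∀ u, f (-u) = f u := comb_neg hf
  have heven : ∀ u, F (-u) = F u := fun u => by rw [hFapp, hFapp, hfeven u]
  have hherm : ∀ u : ℝ, F (-u) = (starRingEnd ℂ) (F u) := fun u => by
    rw [heven, hFapp, Complex.conj_ofReal]
  have hdom : ∀ u : ℝ, ‖F u‖ ≤ (F 0).re := fun u => by
    rw [hF0, Complex.one_re, hFapp, Complex.norm_real, Real.norm_eq_abs]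
    exact comb_abs_le_one hf W_far W_sep u
  have hnodes : ∀ n : ℕ, 2 ≤ n → 0 ≤ (F (Real.log n)).re := fun n hn => by
    rw [hFapp, sw_node hb₀out hbout hc hf hn]; simp
  have hFre : ∀ u, (F u).re = f u := fun u => by rw [hFapp, Complex.ofReal_re]
  have hwin : (∃ T : ℝ, 3 ≤ T ∧ ∀ t : ℝ, Real.log 2 ≤ |t| → (F t).re < 0 → T ≤ |t| ∧ |t| ≤ T + Real.log 2) := by
    refine ⟨3, le_rfl, fun t ht hneg => ?_⟩
    have hl2 := Real.log_two_gt_d9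
    have hft : f |t| < 0 := by
      rw [hFre] at hneg
      rcases le_or_gt 0 t with h0 | h0
      · rwa [abs_of_nonneg h0]
      · rwa [abs_of_neg h0, hfeven]
    have hne : f |t| ≠ 0 := hft.ne
    refine ⟨?_, ?_⟩
    · by_contra hlt
      exact hne (hzeroM |t| (by linarith) (by linarith [not_le.1 hlt]))
    · by_contra hgt
      exact hne (hzeroR |t| (by rw [abs_abs]; linarith [not_le.1 hgt]))
  have hosc : ∃ t : ℝ, Real.log 2 ≤ |t| ∧ (F t).re < 0 := by
    refine ⟨3.0217, ?_, ?_⟩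
    · rw [abs_of_pos (by norm_num)]; linarith [Real.log_two_lt_d9]
    · rw [hFre, sw_neg_pt hb₀out hbin hbout hc hf]; norm_num
  /- ### the mutated statement at the witness -/
  have key : -(F 0).re ≤ (weilPolarTerm F + weilArchTerm F).re :=
    h 1.67 (by norm_num) F ⟨hFtest, hsupp⟩ hherm hdom hnodes hwin hosc
  rw [hF0, Complex.one_re] at key
  /- ### the polar term: `Re = 2 ∫_{t>0} p`, `p(t) = f(t)(e^{-t/2} + e^{t/2})` -/
  obtain ⟨p, hp⟩ : ∃ p : ℝ → ℝ, p = fun t => f t * (Real.exp (-(t / 2)) + Real.exp (t / 2)) := ⟨_, rfl⟩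
  have hp_cont : Continuous p := by
    rw [hp]; exact hfs.continuous.mul (by fun_prop)
  have hp_int : Integrable p := by
    refine hp_cont.integrable_of_hasCompactSupport ?_
    rw [hp]; exact hfc.mul_right
  have hpolar : (weilPolarTerm F).re = 2 * ∫ t in Ioi (0 : ℝ), p t := by
    have hI := fun s : ℂ => integrable_weilIntegrand hFtest.1.continuous hFtest.2 s
    have e1 : weilPolarTerm F = ∫ t : ℝ, F t * (cexp ((0 - 1 / 2) * t) + cexp ((1 - 1 / 2) * t)) := by
      unfold weilPolarTerm weilMellin
      rw [← integral_add (hI 0) (hI 1)]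
      congr 1 with t
      ring
    have hpt : ∀ t : ℝ, F t * (cexp ((0 - 1 / 2) * t) + cexp ((1 - 1 / 2) * t)) = ((p t : ℝ) : ℂ) := by
      intro t
      have ea : cexp ((0 - 1 / 2) * (t : ℂ)) = ((Real.exp (-(t / 2)) : ℝ) : ℂ) := by
        rw [Complex.ofReal_exp]; congr 1; push_cast; ring
      have eb : cexp ((1 - 1 / 2) * (t : ℂ)) = ((Real.exp (t / 2) : ℝ) : ℂ) := by
        rw [Complex.ofReal_exp]; congr 1; push_cast; ring
      rw [ea, eb, hFapp, hp]
      push_cast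
      ring
    have habs : ∀ t : ℝ, p |t| = p t := by
      intro t
      rcases le_or_gt 0 t with ht | ht
      · rw [abs_of_nonneg ht]
      · rw [abs_of_neg ht, hp]
        simp only
        rw [hfeven, neg_div, neg_neg, add_comm]
    rw [e1]
    simp_rw [hpt]
    rw [integral_complex_ofReal, Complex.ofReal_re, ← integral_comp_abs]
    exact integral_congr_ae (Eventually.of_forall fun t => (habs t).symm)
  /- ### the archimedean term (Bombieri): `Re = -(log 4π + γ) - ∫_{t>0} q`, `q(t) = (e^{t/2} f(t) - 1)/sinh t` -/
  obtain ⟨q, hq⟩ : ∃ q : ℝ → ℝ, q = fun t => (Real.exp (t / 2) * f t - 1) / Real.sinh t := ⟨_, rfl⟩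
  have harch : (weilArchTerm F).re =
      -(Real.log (4 * Real.pi) + Real.eulerMascheroniConstant) - ∫ t in Ioi (0 : ℝ), q t := by
    rw [← weilArchTermBombieri_eq_weilArchTerm_holds hFtest, weilArchTermBombieri_eq, hF0]
    have hint_eq : ∀ t ∈ Ioi (0 : ℝ),
        ((Real.exp (t / 2) : ℂ) * (F t + F (-t)) - 2 * (1 : ℂ)) / (2 * Real.sinh t : ℂ) = ((q t : ℝ) : ℂ) := by
      intro t ht
      have ht0 : 0 < t := ht
      have hs : (Real.sinh t : ℂ) ≠ 0 := by exact_mod_cast (Real.sinh_pos_iff.2 ht0).ne'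
      have hs' : Real.sinh t ≠ 0 := (Real.sinh_pos_iff.2 ht0).ne'
      rw [heven t, hFapp, hq]
      push_cast
      field_simp
      ring
    rw [setIntegral_congr_fun measurableSet_Ioi hint_eq, integral_complex_ofReal]
    simp only [mul_one, Complex.sub_re, Complex.neg_re, Complex.add_re, Complex.ofReal_re]
  /- ### integrability of `q` on `(0, ∞)` (Bombieri's majorant) -/
  have hk : IsWeilTest (fun t => F t + F (-t)) :=
    hFtest.add ⟨hFtest.1.comp contDiff_neg, hFtest.2.comp_homeomorph (Homeomorph.neg ℝ)⟩
  have hq_int : IntegrableOn q (Ioi 0) := by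
    have hm := integrableOn_bombieriMajorant hk
    refine Integrable.mono' hm ?_ ?_
    · have hcont : ContinuousOn q (Ioi 0) := by
        rw [hq]
        refine ContinuousOn.div ?_ Real.continuous_sinh.continuousOn fun t ht =>
          (Real.sinh_pos_iff.2 (show 0 < t from ht)).ne'
        exact (((Real.continuous_exp.comp (continuous_id.div_const 2)).mul hfs.continuous).sub
          continuous_const).continuousOn
      exact hcont.aestronglyMeasurable measurableSet_Ioi
    · refine (ae_restrict_iff' measurableSet_Ioi).2 (Eventually.of_forall fun t (ht : 0 < t) => ?_)
      have hs : 0 < Real.sinh t := Real.sinh_pos_iff.2 ht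
      have e : (Real.exp (t / 2) : ℂ) * (F t + F (-t)) - (F 0 + F (-0)) =
          (((2 * (Real.exp (t / 2) * f t - 1)) : ℝ) : ℂ) := by
        rw [heven t, neg_zero, hF0, hFapp]
        push_cast
        ring
      show ‖q t‖ ≤ ‖(Real.exp (t / 2) : ℂ) * (F t + F (-t)) - (F 0 + F (-0))‖ / (2 * Real.sinh t)
      rw [e, Complex.norm_real, Real.norm_eq_abs, Real.norm_eq_abs, hq]
      simp only
      rw [abs_div, abs_of_pos hs, abs_mul, abs_two, mul_div_mul_left _ _ (two_ne_zero)]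
  /- ### the combined density `D = 2p - q` on `(0, ∞)` -/
  obtain ⟨D, hDdef⟩ : ∃ D : ℝ → ℝ, D = fun t => 2 * (f t * (Real.exp (-(t / 2)) + Real.exp (t / 2))) -
      (Real.exp (t / 2) * f t - 1) / Real.sinh t := ⟨_, rfl⟩
  have hD_eq : ∀ t, 0 < t → D t = f t * (2 * (Real.exp (t / 2) + (Real.exp (t / 2))⁻¹) -
      2 * Real.exp (t / 2) ^ 3 / (Real.exp (t / 2) ^ 4 - 1)) +
        2 * Real.exp (t / 2) ^ 2 / (Real.exp (t / 2) ^ 4 - 1) := fun t ht => by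
    rw [hDdef]
    exact dfun_eq (f t) t ht
  have hDpq : D = fun t => 2 * p t - q t := by
    rw [hDdef, hp, hq]
  have hp2 : IntegrableOn (fun t => 2 * p t) (Ioi 0) := (hp_int.const_mul 2).integrableOn
  have hD_int : IntegrableOn D (Ioi 0) := by
    rw [hDpq]
    exact hp2.sub hq_int
  have hcomb : (weilPolarTerm F + weilArchTerm F).re + 1 =
      1 - (Real.log (4 * Real.pi) + Real.eulerMascheroniConstant) + ∫ t in Ioi (0 : ℝ), D t := by
    rw [Complex.add_re, hpolar, harch, hDpq, integral_sub hp2 hq_int, MeasureTheory.integral_const_mul]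
    ring
  /- ### splitting at `T = 3.3312`: 25 cells and a tail -/
  have hT : (0 : ℝ) ≤ 3.3312 := by norm_num
  have hsplit : ∫ t in Ioi (0 : ℝ), D t = (∫ t in (0 : ℝ)..3.3312, D t) + ∫ t in Ioi (3.3312 : ℝ), D t := by
    rw [intervalIntegral.integral_of_le hT, ← setIntegral_union Ioc_disjoint_Ioi_same measurableSet_Ioi
      (hD_int.mono_set Ioc_subset_Ioi_self) (hD_int.mono_set (Ioi_subset_Ioi hT)), Ioc_union_Ioi_eq_Ioi hT]
  obtain ⟨x, hx⟩ : ∃ x : ℕ → ℝ, x = fun i => ([(0 : ℝ), 0.28, 0.32, 0.36, 0.5, 0.64, 0.68, 0.74, 0.82, 0.92, 1.04, 1.18, 1.35, 1.55, 1.8, 2.12, 2.52, 3.0033, 3.0401, 3.1814, 3.2155, 3.2222, 3.254, 3.2992, 3.3282, 3.3312] : List ℝ).getD i 3.3312 := ⟨_, rfl⟩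
  obtain ⟨Mv, hM⟩ : ∃ Mv : ℕ → ℝ, Mv = fun i => ([(4.03928 : ℝ), 3.97114, 3.07231, 1.90855, 0.25749, 1.46073, 1.3631, 1.23548, 1.09287, 0.94754, 0.80785, 0.67865, 0.55585, 0.44454, 0.3399, 0.24359, 0.16198, -8.87757, 0.09589, -9.73045, 0.08042, -9.93612, 0.07737, -10.33533, 0.07182] : List ℝ).getD i 0 := ⟨_, rfl⟩
  obtain ⟨hx0, hxn, hmono, hxnn⟩ := sw_grid_facts hx
  have hint : ∀ i < 25, IntervalIntegrable D volume (x i) (x (i + 1)) := fun i hi =>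
    (intervalIntegrable_iff_integrableOn_Ioc_of_le (hmono i hi)).2
      (hD_int.mono_set (Ioc_subset_Ioi_self.trans (Ioi_subset_Ioi (hxnn i hi))))
  have hbound := sw_cells_dispatch hx hM hD_eq W_pos1 W_possh W_nonpos W_plateau
  have hcells : ∫ t in (0 : ℝ)..3.3312, D t ≤ 1.6569 := by
    have h1 := integral_le_sum_cells hint hmono hbound
    rw [hx0, hxn] at h1
    exact le_trans h1 (sw_cells_sum hx hM)
  /- ### the tail `t ≥ 3.3312` -/
  have htail : ∫ t in Ioi (3.3312 : ℝ), D t ≤ 0.07161 := by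
    have hTpos : (0 : ℝ) < 3.3312 := by norm_num
    have hDtail : ∀ t ∈ Ioi (3.3312 : ℝ), D t ≤ 2 / (1 - Real.exp (-(2 * 3.3312))) * Real.exp (-t) := by
      intro t ht
      have ht' : (3.3312 : ℝ) < t := ht
      have ht0 : 0 < t := by linarith
      have hft : f t = 0 := hzeroR t (by rw [abs_of_pos ht0]; exact ht'.le)
      rw [hD_eq t ht0, hft, zero_mul, zero_add]
      exact tail_pointwise hTpos ht'.le
    have hmaj : IntegrableOn (fun t : ℝ => 2 / (1 - Real.exp (-(2 * 3.3312))) * Real.exp (-t)) (Ioi 3.3312) := by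
      have h1 : IntegrableOn (fun t : ℝ => Real.exp (-t)) (Ioi 3.3312) := by
        simpa using exp_neg_integrableOn_Ioi 3.3312 zero_lt_one
      exact h1.const_mul _
    have hle := setIntegral_mono_on (hD_int.mono_set (Ioi_subset_Ioi hTpos.le)) hmaj measurableSet_Ioi hDtail
    rw [MeasureTheory.integral_const_mul, integral_exp_neg_Ioi] at hle
    exact le_trans hle sw_tail_numeric
  /- ### conclusion: `Re W_ar(F) + 1 ≤ 1 - 2.9849 + 1.6569 + 0.07161 < 0` -/
  have hL := budget_le
  have hneg : (weilPolarTerm F + weilArchTerm F).re + 1 < 0 := by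
    rw [hcomb, hsplit]
    linarith [hcells, htail, hL]
  linarith [key, hneg]

end Summit.RiemannHypothesis.RiemannHypothesis.Theorems.OscSingleWindow.Negative

end
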